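import Summits.QuantumFields.YangMills.Theorems.ForcedResponseSkewnessResponseLocalisationGaussSextic
import HarnessLib

/-!
# Crux `ResponseLocalisation` (rev 5 contact crux: stmt-QuantumFields-24869), line «collar-kernel»: the free
# curvature-Gaussian model of the CONTACT KERNEL statement — the lattice-contact term does not run, so the analogue of
# `ContactKernelSigR` FAILS in the abelian model

Sanity helper (`--supports stmt-QuantumFields-24869 --as helper`, lead's WAKE ≈02:55Z target 2) by the width prover
`ym-line-frs-p3` (g2) of route `ForcedResponseSkewness` (lead `ym-line-frs-p1`); sibling of
`…RunningCouplingCeilingGaussModel` (`gaussModel_not_logDecay`, p597038).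

The registered physics stub `stub_contactKernel : ContactKernelSigR` asks, along a PINNED unit `a(β) → 0`, for pairs `(y, z)`
at physical separation in `[r₁, r₂]` and every `κ > 0`, a radius `R > 0` with
`Σ_{x : a·d(x,z) < R} |torusK3 β L x y z| ≤ κ·a⁸` — the integrated near-insertion (contact) coefficient VANISHES with the cut,
which in Yang–Mills is asymptotic freedom: the lattice-contact term `g₀²/2` and the shell `(ḡ²(R) − g₀²)/2` both run to `0`
(lead's `…ContactOneLoop`, p598136).  Here we evaluate the same quantity in the tree's FREE model — the curvature Gaussian field
`γ = curvatureGaussianField 4 1` (one colour = the abelian/`U(1)` case; plaquette field strengths `Y_p` with covariance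
`C = curvatureTwoPoint`), composite `A_w = (λ/2)·Y(p₁₂ w)² − (λ/2)·C(0)` (centred square, as in the record-label lines) and model
third cumulant `κ₃^free(x, y, z) = E_γ[A_x A_y A_z]`:

* §1 (sextic Wick toolkit, sibling file `…ResponseLocalisationGaussSextic`): `∫ L₁⁴ L₂² dμ_K = 3 G₁₁² G₂₂ + 12 G₁₁ G₁₂²`
  and the lattice-contact value `E[(ω_s² − K_ss)² (ω_t² − K_tt)] = 8 K_ss K_st²` (`integral_centredSq_sq_mul_centredSq`);
* §2 (the free contact term): for one colour and the `(1,2)`-plaquette composite, along the time axis (`p = p₁₂ z`, `q = p₁₂(z + n e₀)`): **`κ₃^free(z, z + n e₀, z) = λ³ C(0) c_n²`**, `C(0) = ½`,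
  `c_n = curvaturePlaquetteCorr 4 n` (`gaussModel_contactTerm_eq`);
* §3 (negative sanity): with the axis floor `κ_f/n⁴ ≤ |c_n|` (hypothesis `hfloor` = body of route `WeakCouplingRates`' CLOSED
  item `CurvatureCorrPowerFloor`, proved in tree by `WeakCouplingRates.curvatureCorrPowerFloor_proof`; taken as a hypothesis to
  stay outside that route file's import cone) the lattice-contact term at unit `t` with `t·n ≤ r₂` obeys
  `n⁸·|κ₃^free(z, z+ne₀, z)| ≥ c₀ = |λ|³ κ_f²/2`, i.e. `|κ₃^free| ≥ (c₀/r₂⁸)·t⁸` (`gaussModel_contactTerm_floor`), whence **`gaussModel_not_contactKernel`**: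
  for `λ ≠ 0` and any window `0 < r₁ ≤ r₂` it is FALSE that for every `κ > 0` some unit threshold `t₀ > 0` makes
  `|κ₃^free(z, y, z)| ≤ κ·t⁸` for all `0 < t ≤ t₀` and all axis pairs `y = z + n e₀` with `t·n ∈ [r₁, r₂]`.  Since the `x = z`
  term lies in EVERY ball `{x : t·d(x,z) < R}`, `R > 0`, the free analogue of `ContactKernelSigR` (near-insertion mass
  `≤ κ t⁸` for some `R`) fails a fortiori: in the free model the contact coefficient is PINNED at its tree value
  `λ³C(0)c_n²·n⁸ ≍ λ³` (no running, `b₀ = 0`), exactly the lead's instrument reading; the lever of the crux is `b₀ > 0`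
  (barrier `AbelianDeconfinementD4` consistent: the abelian theory carries no such localisation).

No `def … : Prop`, no new definition: the model kernel is written out explicitly.  Honest label: a computation in the FREE
model; nothing here is a statement about lattice Yang–Mills, no stub of 24869 is closed, and nothing bears on the Yang–Mills mass
gap, which is NOT proved by any of this.  Conditional rung line (leaf R2a `BalabanLadder.NT`).  Isserlis (1918); Janson,
*Gaussian Hilbert Spaces* (1997) Thm 1.28 / Rem. 1.30. [folklore]
-/

set_option autoImplicit false

noncomputable section

open MeasureTheory ProbabilityTheory
open Literature.MathematicalPhysics.QuantumFieldTheory Literature.MathematicalPhysics.QuantumLattice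
open Literature.MathematicalPhysics.QuantumFieldTheory.Balaban1983to89.B3WTFreeMeasure
open Summit.QuantumFields.YangMills.Cruxes.SourcedPressureIncrement.Birth

namespace Summit.QuantumFields.YangMills.Cruxes.ResponseLocalisation.GaussModel

/-! ### §2′ The free model on `ℤ⁴`, one colour: the contact term of the third cumulant along the time axis -/

section Contact

open Literature.Probability.LatticeModels

/-- **The free lattice-contact term.**  For the curvature Gaussian field on `ℤ⁴` with ONE colour, composite
`A_w = (λ/2)·Y(p₁₂ w)² − (λ/2)·C(0)`, base site `z` and axis partner `y = z + n e₀`: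
`κ₃^free(z, y, z) = E_γ[A_z A_y A_z] = λ³ · C(0) · c_n²`, `c_n = curvaturePlaquetteCorr 4 n`, `C(0) = c_0 (= ½)`. [folklore] -/
theorem gaussModel_contactTerm_eq (lam : ℝ) (z : Site 4) (n : ℕ) :
    ∫ Y, (lam / 2 * (Y (plaquette12 (d := 4) (by norm_num) z) 0) ^ 2 -
            lam / 2 * curvaturePlaquetteCorr (d := 4) (by norm_num) 0) *
          (lam / 2 * (Y (plaquette12 (d := 4) (by norm_num) (z + Pi.single (0 : Fin 4) (n : ℤ))) 0) ^ 2 -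
            lam / 2 * curvaturePlaquetteCorr (d := 4) (by norm_num) 0) *
          (lam / 2 * (Y (plaquette12 (d := 4) (by norm_num) z) 0) ^ 2 -
            lam / 2 * curvaturePlaquetteCorr (d := 4) (by norm_num) 0)
        ∂curvatureGaussianField (d := 4) 1 =
      lam ^ 3 * curvaturePlaquetteCorr (d := 4) (by norm_num) 0 *
        (curvaturePlaquetteCorr (d := 4) (by norm_num) (n : ℤ)) ^ 2 := by
  have hd : 3 ≤ 4 := by norm_num
  have hK := isPosSemidefKernel_curvatureCovKernel (d := 4) hd 1
  have h0 : (⟨0, by omega⟩ : Fin 4) = 0 := rfl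
  set p := plaquette12 (d := 4) hd z with hp
  set q := plaquette12 (d := 4) hd (z + Pi.single (0 : Fin 4) (n : ℤ)) with hq
  set C0 : ℝ := curvaturePlaquetteCorr (d := 4) hd 0 with hC0
  have hpp : curvatureCovKernel (d := 4) 1 (p, 0) (p, 0) = C0 := by
    rw [curvatureCovKernel_apply, if_pos rfl, hp, curvatureTwoPoint_plaquette12_self hd z]
  have hqq : curvatureCovKernel (d := 4) 1 (q, 0) (q, 0) = C0 := by
    rw [curvatureCovKernel_apply, if_pos rfl, hq, curvatureTwoPoint_plaquette12_self hd]
  have hpq : curvatureCovKernel (d := 4) 1 (p, 0) (q, 0) = curvaturePlaquetteCorr (d := 4) hd (n : ℤ) := by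
    have h := curvatureTwoPoint_plaquette12_shift hd z (n : ℤ)
    rw [h0] at h
    rw [curvatureCovKernel_apply, if_pos rfl, hp, hq, h]
  rw [integral_curvatureGaussianField_eq]
  have e : ∀ ω : ZdPlaquette 4 × Fin 1 → ℝ,
      (lam / 2 * (ω (p, 0)) ^ 2 - lam / 2 * C0) * (lam / 2 * (ω (q, 0)) ^ 2 - lam / 2 * C0) *
          (lam / 2 * (ω (p, 0)) ^ 2 - lam / 2 * C0) =
        (lam / 2) ^ 3 * ((ω (p, 0) ^ 2 - C0) ^ 2 * (ω (q, 0) ^ 2 - C0)) := fun ω => by ring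
  simp_rw [e]
  rw [integral_const_mul, integral_centredSq_sq_mul_centredSq hK (p, 0) (q, 0) hpp hqq, hpq]
  ring

/-- **Floor on the free contact term** (given the axis floor `hfloor` = body of `WeakCouplingRates.CurvatureCorrPowerFloor`, proved
in tree): for `λ ≠ 0` there are `c₀ > 0` and `n₁ ≥ 1` with `c₀ ≤ n⁸ · |κ₃^free(z, z + n e₀, z)|` for all `z` and `n ≥ n₁`
(`c₀ = |λ|³ C(0) κ_f²`, `C(0) = ½`). [folklore] -/
theorem gaussModel_contactTerm_floor (lam : ℝ) (hlam : lam ≠ 0)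
    (hfloor : ∃ κ : ℝ, 0 < κ ∧ ∃ n₀ : ℕ, ∀ n : ℕ, n₀ ≤ n →
      κ / (n : ℝ) ^ 4 ≤ |curvaturePlaquetteCorr (d := 4) (by norm_num) (n : ℤ)|) :
    ∃ c₀ : ℝ, 0 < c₀ ∧ ∃ n₁ : ℕ, 1 ≤ n₁ ∧ ∀ (z : Site 4) (n : ℕ), n₁ ≤ n →
      c₀ ≤ (n : ℝ) ^ 8 * |∫ Y, (lam / 2 * (Y (plaquette12 (d := 4) (by norm_num) z) 0) ^ 2 -
            lam / 2 * curvaturePlaquetteCorr (d := 4) (by norm_num) 0) *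
          (lam / 2 * (Y (plaquette12 (d := 4) (by norm_num) (z + Pi.single (0 : Fin 4) (n : ℤ))) 0) ^ 2 -
            lam / 2 * curvaturePlaquetteCorr (d := 4) (by norm_num) 0) *
          (lam / 2 * (Y (plaquette12 (d := 4) (by norm_num) z) 0) ^ 2 -
            lam / 2 * curvaturePlaquetteCorr (d := 4) (by norm_num) 0)
        ∂curvatureGaussianField (d := 4) 1| := by
  obtain ⟨κ, hκ, n₀, h⟩ := hfloor
  have hd : 3 ≤ 4 := by norm_num
  have hC0 : curvaturePlaquetteCorr (d := 4) hd 0 = 1 / 2 := by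
    have h1 := curvatureTwoPoint_plaquette12_self hd (0 : Site 4)
    rw [curvatureTwoPoint_self hd] at h1
    rw [← h1]
    norm_num
  have hl : 0 < |lam| ^ 3 := by positivity
  refine ⟨|lam| ^ 3 * (1 / 2) * κ ^ 2, by positivity, max n₀ 1, le_max_right _ _, fun z n hn => ?_⟩
  have hn1 : 1 ≤ n := le_trans (le_max_right _ _) hn
  have hn0 : (0 : ℝ) < n := by exact_mod_cast hn1
  have hn4 : (0 : ℝ) < (n : ℝ) ^ 4 := by positivity
  rw [gaussModel_contactTerm_eq lam z n, hC0]
  set c : ℝ := curvaturePlaquetteCorr (d := 4) hd (n : ℤ) with hc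
  have h1 := h n (le_trans (le_max_left _ _) hn)
  rw [← hc] at h1
  have h2 : κ ≤ |c| * (n : ℝ) ^ 4 := (div_le_iff₀ hn4).1 h1
  have h3 : κ ^ 2 ≤ (|c| * (n : ℝ) ^ 4) ^ 2 := pow_le_pow_left₀ hκ.le h2 2
  rw [abs_mul, abs_mul, abs_pow, abs_of_pos (by norm_num : (0 : ℝ) < 1 / 2), abs_of_nonneg (sq_nonneg c)]
  calc |lam| ^ 3 * (1 / 2) * κ ^ 2 ≤ |lam| ^ 3 * (1 / 2) * (|c| * (n : ℝ) ^ 4) ^ 2 :=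
        mul_le_mul_of_nonneg_left h3 (by positivity)
    _ = (n : ℝ) ^ 8 * (|lam| ^ 3 * (1 / 2) * c ^ 2) := by rw [mul_pow, sq_abs]; ring

/-- **`gaussModel_not_contactKernel` — the contact-kernel statement FAILS in the free (abelian) model.**  For the one-colour
curvature Gaussian field on `ℤ⁴` (composite `A_w = (λ/2)·Y(p₁₂ w)² − (λ/2)·C(0)`, `λ ≠ 0`), the axis floor `hfloor`
(= `WeakCouplingRates.CurvatureCorrPowerFloor`, proved in tree) and any separation window `0 < r₁ ≤ r₂`: it is NOT the case that
for every `κ > 0` some unit threshold `t₀ > 0` gives `|κ₃^free(z, y, z)| ≤ κ·t⁸` for all units `0 < t ≤ t₀` and all axis pairs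
`y = z + n e₀` at physical separation `t·n ∈ [r₁, r₂]`.  The `x = z` lattice-contact term belongs to every ball
`{x : t·d(x, z) < R}` (`R > 0`), so the free analogue of `ContactKernelSigR` — near-insertion mass `≤ κ·t⁸` beyond some
radius `R` — fails a fortiori: without running (`b₀ = 0`) the contact coefficient is pinned at its tree value
`λ³ C(0) c_n² n⁸`, `≥ c₀ = |λ|³κ_f²/2` in size.  (Witness: `κ = c₀/(4 r₂⁸)`, `t = r₂/n`, `n → ∞`.) [folklore] -/
theorem gaussModel_not_contactKernel (lam : ℝ) (hlam : lam ≠ 0)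
    (hfloor : ∃ κ : ℝ, 0 < κ ∧ ∃ n₀ : ℕ, ∀ n : ℕ, n₀ ≤ n →
      κ / (n : ℝ) ^ 4 ≤ |curvaturePlaquetteCorr (d := 4) (by norm_num) (n : ℤ)|)
    (r₁ r₂ : ℝ) (hr₁ : 0 < r₁) (hr₁₂ : r₁ ≤ r₂) :
    ¬ ∀ κ : ℝ, 0 < κ → ∃ t₀ : ℝ, 0 < t₀ ∧ ∀ t : ℝ, 0 < t → t ≤ t₀ → ∀ (z : Site 4) (n : ℕ),
      r₁ ≤ t * n → t * n ≤ r₂ →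
        |∫ Y, (lam / 2 * (Y (plaquette12 (d := 4) (by norm_num) z) 0) ^ 2 -
              lam / 2 * curvaturePlaquetteCorr (d := 4) (by norm_num) 0) *
            (lam / 2 * (Y (plaquette12 (d := 4) (by norm_num) (z + Pi.single (0 : Fin 4) (n : ℤ))) 0) ^ 2 -
              lam / 2 * curvaturePlaquetteCorr (d := 4) (by norm_num) 0) *
            (lam / 2 * (Y (plaquette12 (d := 4) (by norm_num) z) 0) ^ 2 -
              lam / 2 * curvaturePlaquetteCorr (d := 4) (by norm_num) 0)
          ∂curvatureGaussianField (d := 4) 1| ≤ κ * t ^ 8 := by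
  intro H
  obtain ⟨c₀, hc₀, n₁, hn₁, hfl⟩ := gaussModel_contactTerm_floor lam hlam hfloor
  have hr₂ : 0 < r₂ := lt_of_lt_of_le hr₁ hr₁₂
  obtain ⟨t₀, ht₀, ht⟩ := H (c₀ / (4 * r₂ ^ 8)) (by positivity)
  -- the lattice separation `n` and the unit `t = r₂ / n`
  set n : ℕ := max n₁ ⌈r₂ / t₀⌉₊ with hn_def
  have hn1 : 1 ≤ n := le_trans hn₁ (le_max_left _ _)
  have hn0 : (0 : ℝ) < n := by exact_mod_cast hn1
  have hnceil : r₂ / t₀ ≤ (n : ℝ) := le_trans (Nat.le_ceil _) (by exact_mod_cast le_max_right n₁ ⌈r₂ / t₀⌉₊)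
  set t : ℝ := r₂ / n with ht_def
  have htpos : 0 < t := by positivity
  have htn : t * n = r₂ := by rw [ht_def]; field_simp
  have htle : t ≤ t₀ := by
    rw [ht_def, div_le_iff₀ hn0]
    rw [div_le_iff₀ ht₀] at hnceil
    linarith
  have hmain := ht t htpos htle (0 : Site 4) n (by rw [htn]; exact hr₁₂) (by rw [htn])
  have hV := hfl (0 : Site 4) n (le_max_left _ _)
  set V : ℝ := |∫ Y, (lam / 2 * (Y (plaquette12 (d := 4) (by norm_num) (0 : Site 4)) 0) ^ 2 -
              lam / 2 * curvaturePlaquetteCorr (d := 4) (by norm_num) 0) *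
            (lam / 2 * (Y (plaquette12 (d := 4) (by norm_num) ((0 : Site 4) + Pi.single (0 : Fin 4) (n : ℤ))) 0) ^ 2 -
              lam / 2 * curvaturePlaquetteCorr (d := 4) (by norm_num) 0) *
            (lam / 2 * (Y (plaquette12 (d := 4) (by norm_num) (0 : Site 4)) 0) ^ 2 -
              lam / 2 * curvaturePlaquetteCorr (d := 4) (by norm_num) 0)
          ∂curvatureGaussianField (d := 4) 1| with hV_def
  have h1 : (n : ℝ) ^ 8 * V ≤ (n : ℝ) ^ 8 * (c₀ / (4 * r₂ ^ 8) * t ^ 8) :=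
    mul_le_mul_of_nonneg_left hmain (by positivity)
  have e : (n : ℝ) ^ 8 * (c₀ / (4 * r₂ ^ 8) * t ^ 8) = c₀ / 4 := by
    rw [ht_def]
    field_simp
  linarith

end Contact


end Summit.QuantumFields.YangMills.Cruxes.ResponseLocalisation.GaussModel

end
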